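/-
Copyright: the b2b-balaban T⁴-continuum CRUX team, row NE7b OWNER lineage `t4-ne7b-p1` (gen 141). Project licence.
-/
import Summits.QuantumFields.BalabanUV.T4Continuum.Spine.NE7b.SupTiltedMomentConstituents

/-!
# THE FOURTH CONSTITUENT `Φ_{hkl}` AND ITS `ψ`-DERIVATIVE — THE FOURTH-ORDER TILTED INTEGRAND (SCOPING (d13)(2): the cumulant FORM of
# `∂⁴W`, third file; `U ∈ C⁴`).  (472)'s last scalar integral `Φ_{hkl} = ∫e^{−U}p₃`, `p₃ = U‴hkl − U′k·U″hl − U″hk·U′l − U′h·U″kl + U′hU′kU′l` (at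
# `ω+ψ`), has a `C¹` observable when `U ∈ C⁴` (`HasFDerivAt U‴ (U⁗φ) φ`, `U⁗` continuous, `‖U⁗‖ ≤ κ₄`), of growth `(1+3κ₂+3κ₂²+4κ₃+κ₄)(1+‖U′‖)³`
# together with its derivative; (513) then gives, for directions of norm `≤ 1`, at EVERY `ψ₀`,
#   `d_m Φ_{hkl} = ∫e^{−U}Ψ_{hklm}`,   `Ψ_{hklm} = U⁗mhkl − U′k·U‴mhl − U″hl·U″mk − U″hk·U″ml − U′l·U‴mhk − U′h·U‴mkl − U″kl·U″mh`
#                                      `+ U′hU′k·U″ml + U′hU′l·U″mk + U′kU′l·U″mh − p₃·U′m`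
# — the order-4 analog of (418)'s `Φ`, in scalar clothing, for a general `Γ ⪰ 0` under the regulator (row NE7b, node U5c; (513), (514) BY NAME;
# [folklore])

Cell `pub-balaban`, sub-cell `t4`, spine estimate NE7b (`T4WeightBudget.RelWeightBound`; the cell's OWN estimate — NOT PRINTED in
[Bałaban 1983–89], NOT PROVED).  Crux-route work under `Spine/NE7b/` by the row OWNER (`t4-ne7b-p1` gen 141, file (515)) under FREEZE
(0)'s crux-prover clause; NOTHING of Bałaban's is named as a Lean object, valued or asserted; no `T4Continuum/Support` leaf typed; no
`def`, no notation; zero `sorry`.  Imports (BY NAME): the OWNER's (514) `…SupTiltedMomentConstituents` (`hasFDerivAt_entry_one`,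
`hasFDerivAt_entry_two`, `norm_eval_comp_one_le`, `norm_eval_comp_two_le`, `abs_entry_one_le`, `abs_entry_two_le`; through it (513)
`hasFDerivAt_tilted_moment`, `tilted_moment_fderiv_apply`).

WHAT IS PROVED ([folklore]):
* §1 `hasFDerivAt_entry_three`, `norm_eval_comp_three_le`, `abs_entry_three_le`; `hasFDerivAt_obs_three`, `abs_obs_three_le`,
  `norm_obs_three_deriv_le`, `continuous_obs_three_deriv`.
* §2 THE ENDS **`hasFDerivAt_Phi_scalar`**, **`Phi_fderiv_apply`**; §3 toy.

HONEST (what this is NOT).  The last constituent; the entries of `∂⁴W` (the quotient rule on (472)'s `T = Z⁻¹Φ + Z⁻²(GH+GH+HG) + 2Z⁻³GGG`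
along a direction, with (514)'s and this file's derivatives), the centred regrouping and the assembly are the next files.  Scalar skeleton
((A3), NC-NE7b-α UNRULED); nothing of Bałaban's asserted.  BY-NAME EFFECT ON THE WALL: NONE.  NE7b NOT PRINTED ∕ NOT PROVED; spine PROVED
0∕9; rung (B)+1 — the programme's measures remain FINITE-torus statements; NOT the mass gap, NOT Clay.  HONEST DEPENDENCY: continuum YM on
T⁴ ⇐ BetaPertH ∧ nine spine estimates (0∕9 proved); BetaPertH ⇐ (D1) ∧ (D4) ∧ CAP+tail; G-an2-4 gates asym, D1 and NE2∕3∕4.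
-/

set_option autoImplicit false
set_option maxSynthPendingDepth 3

noncomputable section

namespace Summit.QuantumFields.BalabanUV.T4Continuum.NE7b.SupTiltedMomentPhiConstituent

open MeasureTheory ProbabilityTheory Finset Real Metric Filter
open scoped BigOperators Topology
open SupTiltedScalarMomentCalculus (hasFDerivAt_tilted_moment tilted_moment_fderiv_apply)
open SupTiltedMomentConstituents (hasFDerivAt_entry_one hasFDerivAt_entry_two norm_eval_comp_one_le norm_eval_comp_two_le abs_entry_one_le
  abs_entry_two_le)

variable {ι : Type} [Fintype ι] [DecidableEq ι]

/-! ## §1. The third entry observable and `p₃` -/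

section Entries

variable {U' : EuclideanSpace ℝ ι → EuclideanSpace ℝ ι →L[ℝ] ℝ} {U'' : EuclideanSpace ℝ ι → EuclideanSpace ℝ ι →L[ℝ] EuclideanSpace ℝ ι →L[ℝ] ℝ}
  {U₃ : EuclideanSpace ℝ ι → EuclideanSpace ℝ ι →L[ℝ] EuclideanSpace ℝ ι →L[ℝ] EuclideanSpace ℝ ι →L[ℝ] ℝ}
  {U₄ : EuclideanSpace ℝ ι → EuclideanSpace ℝ ι →L[ℝ] EuclideanSpace ℝ ι →L[ℝ] EuclideanSpace ℝ ι →L[ℝ] EuclideanSpace ℝ ι →L[ℝ] ℝ} {κ₂ κ₃ κ₄ : ℝ}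
  {h k l : EuclideanSpace ℝ ι}

omit [DecidableEq ι] in
/-- `φ ↦ U‴φ h k l` has derivative `(ev_l ∘ ev_k ∘ ev_h) ∘ U⁗φ`. [folklore] -/
theorem hasFDerivAt_entry_three (hU₃d : ∀ φ : EuclideanSpace ℝ ι, HasFDerivAt U₃ (U₄ φ) φ) (h k l φ : EuclideanSpace ℝ ι) :
    HasFDerivAt (fun φ : EuclideanSpace ℝ ι => U₃ φ h k l) ((((ContinuousLinearMap.apply ℝ ℝ l).comp (ContinuousLinearMap.apply ℝ (EuclideanSpace ℝ ι
        →L[ℝ] ℝ) k)).comp (ContinuousLinearMap.apply ℝ (EuclideanSpace ℝ ι →L[ℝ] EuclideanSpace ℝ ι →L[ℝ] ℝ) h)).comp (U₄ φ)) φ := by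
  have h1 := ((((ContinuousLinearMap.apply ℝ ℝ l).comp (ContinuousLinearMap.apply ℝ (EuclideanSpace ℝ ι →L[ℝ] ℝ) k)).comp (ContinuousLinearMap.apply
      ℝ (EuclideanSpace ℝ ι →L[ℝ] EuclideanSpace ℝ ι →L[ℝ] ℝ) h))).hasFDerivAt.comp φ (hU₃d φ)
  simpa [Function.comp_def] using h1

omit [DecidableEq ι] in
/-- `‖(ev_l ∘ ev_k ∘ ev_h) ∘ Q‖ ≤ ‖h‖‖k‖‖l‖‖Q‖`. [folklore] -/
theorem norm_eval_comp_three_le (Q : EuclideanSpace ℝ ι →L[ℝ] EuclideanSpace ℝ ι →L[ℝ] EuclideanSpace ℝ ι →L[ℝ] EuclideanSpace ℝ ι →L[ℝ] ℝ)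
    (h k l : EuclideanSpace ℝ ι) : ‖((((ContinuousLinearMap.apply ℝ ℝ l).comp (ContinuousLinearMap.apply ℝ (EuclideanSpace ℝ ι →L[ℝ] ℝ) k)).comp
        (ContinuousLinearMap.apply ℝ (EuclideanSpace ℝ ι →L[ℝ] EuclideanSpace ℝ ι →L[ℝ] ℝ) h))).comp Q‖ ≤ ‖h‖ * ‖k‖ * ‖l‖ * ‖Q‖ := by
  refine ContinuousLinearMap.opNorm_le_bound _ (by positivity) fun u => ?_
  simp only [ContinuousLinearMap.coe_comp, Function.comp_apply, ContinuousLinearMap.apply_apply]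
  calc ‖Q u h k l‖ ≤ ‖Q u h k‖ * ‖l‖ := ContinuousLinearMap.le_opNorm _ _
    _ ≤ ‖Q u h‖ * ‖k‖ * ‖l‖ := mul_le_mul_of_nonneg_right (ContinuousLinearMap.le_opNorm _ _) (norm_nonneg _)
    _ ≤ ‖Q u‖ * ‖h‖ * ‖k‖ * ‖l‖ := mul_le_mul_of_nonneg_right (mul_le_mul_of_nonneg_right (ContinuousLinearMap.le_opNorm _ _) (norm_nonneg _))
        (norm_nonneg _)
    _ ≤ ‖Q‖ * ‖u‖ * ‖h‖ * ‖k‖ * ‖l‖ := mul_le_mul_of_nonneg_right (mul_le_mul_of_nonneg_right (mul_le_mul_of_nonneg_right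
        (ContinuousLinearMap.le_opNorm _ _) (norm_nonneg _)) (norm_nonneg _)) (norm_nonneg _)
    _ = ‖h‖ * ‖k‖ * ‖l‖ * ‖Q‖ * ‖u‖ := by ring

omit [DecidableEq ι] in
/-- `|U‴φ h k l| ≤ ‖U‴φ‖‖h‖‖k‖‖l‖`. [folklore] -/
theorem abs_entry_three_le (T : EuclideanSpace ℝ ι →L[ℝ] EuclideanSpace ℝ ι →L[ℝ] EuclideanSpace ℝ ι →L[ℝ] ℝ) (h k l : EuclideanSpace ℝ ι) :
    |T h k l| ≤ ‖T‖ * ‖h‖ * ‖k‖ * ‖l‖ := by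
  rw [← Real.norm_eq_abs]
  refine (ContinuousLinearMap.le_opNorm _ _).trans (mul_le_mul_of_nonneg_right ?_ (norm_nonneg _))
  exact (ContinuousLinearMap.le_opNorm _ _).trans (mul_le_mul_of_nonneg_right (ContinuousLinearMap.le_opNorm _ _) (norm_nonneg _))

omit [DecidableEq ι] in
/-- **`p₃ = U‴hkl − U′k·U″hl − U″hk·U′l − U′h·U″kl + U′hU′kU′l` is `C¹`** (the product rule, term by term). [folklore] -/
theorem hasFDerivAt_obs_three (hU'd : ∀ φ : EuclideanSpace ℝ ι, HasFDerivAt U' (U'' φ) φ) (hU''d : ∀ φ : EuclideanSpace ℝ ι, HasFDerivAt U'' (U₃ φ) φ)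
    (hU₃d : ∀ φ : EuclideanSpace ℝ ι, HasFDerivAt U₃ (U₄ φ) φ) (h k l φ : EuclideanSpace ℝ ι) :
    HasFDerivAt (fun φ : EuclideanSpace ℝ ι => (U₃ φ h k l - U' φ k * U'' φ h l - U'' φ h k * U' φ l - U' φ h * U'' φ k l + U' φ h * U' φ k * U' φ l))
      (((((ContinuousLinearMap.apply ℝ ℝ l).comp (ContinuousLinearMap.apply ℝ (EuclideanSpace ℝ ι →L[ℝ] ℝ) k)).comp (ContinuousLinearMap.apply ℝ
          (EuclideanSpace ℝ ι →L[ℝ] EuclideanSpace ℝ ι →L[ℝ] ℝ) h)).comp (U₄ φ)) - (U' φ k • (((ContinuousLinearMap.apply ℝ ℝ l).comp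
          (ContinuousLinearMap.apply ℝ (EuclideanSpace ℝ ι →L[ℝ] ℝ) h)).comp (U₃ φ)) + U'' φ h l • ((ContinuousLinearMap.apply ℝ ℝ k).comp (U'' φ)))
          - (U'' φ h k • ((ContinuousLinearMap.apply ℝ ℝ l).comp (U'' φ)) + U' φ l • (((ContinuousLinearMap.apply ℝ ℝ k).comp
          (ContinuousLinearMap.apply ℝ (EuclideanSpace ℝ ι →L[ℝ] ℝ) h)).comp (U₃ φ))) - (U' φ h • (((ContinuousLinearMap.apply ℝ ℝ l).comp
          (ContinuousLinearMap.apply ℝ (EuclideanSpace ℝ ι →L[ℝ] ℝ) k)).comp (U₃ φ)) + U'' φ k l • ((ContinuousLinearMap.apply ℝ ℝ h).comp (U'' φ)))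
          + ((U' φ h * U' φ k) • ((ContinuousLinearMap.apply ℝ ℝ l).comp (U'' φ)) + U' φ l • (U' φ h • ((ContinuousLinearMap.apply ℝ ℝ k).comp (U''
          φ)) + U' φ k • ((ContinuousLinearMap.apply ℝ ℝ h).comp (U'' φ))))) φ :=
  ((((hasFDerivAt_entry_three hU₃d h k l φ).sub ((hasFDerivAt_entry_one hU'd k φ).mul (hasFDerivAt_entry_two hU''d h l φ))).sub
    ((hasFDerivAt_entry_two hU''d h k φ).mul (hasFDerivAt_entry_one hU'd l φ))).sub
    ((hasFDerivAt_entry_one hU'd h φ).mul (hasFDerivAt_entry_two hU''d k l φ))).add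
    (((hasFDerivAt_entry_one hU'd h φ).mul (hasFDerivAt_entry_one hU'd k φ)).mul (hasFDerivAt_entry_one hU'd l φ))

omit [DecidableEq ι] in
/-- Growth of `p₃`: `|p₃| ≤ (1+3κ₂+3κ₂²+4κ₃+κ₄)(1+‖U′‖)³` for directions of norm `≤ 1`. [folklore] -/
theorem abs_obs_three_le (hU''b : ∀ φ : EuclideanSpace ℝ ι, ‖U'' φ‖ ≤ κ₂) (hU₃b : ∀ φ : EuclideanSpace ℝ ι, ‖U₃ φ‖ ≤ κ₃)
    (hU₄b : ∀ φ : EuclideanSpace ℝ ι, ‖U₄ φ‖ ≤ κ₄) (hh : ‖h‖ ≤ 1) (hk : ‖k‖ ≤ 1) (hl : ‖l‖ ≤ 1) (φ : EuclideanSpace ℝ ι) :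
    |(U₃ φ h k l - U' φ k * U'' φ h l - U'' φ h k * U' φ l - U' φ h * U'' φ k l + U' φ h * U' φ k * U' φ l)| ≤ (1 + 3 * κ₂ + 3 * κ₂ ^ 2 + 4 * κ₃ +
        κ₄) * (1 + ‖U' φ‖) ^ 3 := by
  have hκ₂ : 0 ≤ κ₂ := (norm_nonneg (U'' φ)).trans (hU''b φ)
  have hκ₃ : 0 ≤ κ₃ := (norm_nonneg (U₃ φ)).trans (hU₃b φ)
  have hκ₄ : 0 ≤ κ₄ := (norm_nonneg (U₄ φ)).trans (hU₄b φ)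
  set N := ‖U' φ‖ with hNdef
  have hN : 0 ≤ N := norm_nonneg _
  have hCp1 : 1 ≤ (1 + 3 * κ₂ + 3 * κ₂ ^ 2 + 4 * κ₃ + κ₄) := by nlinarith [sq_nonneg κ₂]
  have hCp3 : κ₃ ≤ (1 + 3 * κ₂ + 3 * κ₂ ^ 2 + 4 * κ₃ + κ₄) := by nlinarith [sq_nonneg κ₂]
  have f1 : N * κ₂ ≤ (1 + 3 * κ₂ + 3 * κ₂ ^ 2 + 4 * κ₃ + κ₄) * N := by nlinarith [sq_nonneg κ₂]
  have f2 : N * N * N ≤ (1 + 3 * κ₂ + 3 * κ₂ ^ 2 + 4 * κ₃ + κ₄) * N ^ 3 := by nlinarith [pow_nonneg hN 3, sq_nonneg κ₂]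
  have f3 : 0 ≤ (1 + 3 * κ₂ + 3 * κ₂ ^ 2 + 4 * κ₃ + κ₄) * N ^ 2 := by positivity
  have hexp : (1 + 3 * κ₂ + 3 * κ₂ ^ 2 + 4 * κ₃ + κ₄) * (1 + N) ^ 3 = (1 + 3 * κ₂ + 3 * κ₂ ^ 2 + 4 * κ₃ + κ₄) + 3 * ((1 + 3 * κ₂ + 3 * κ₂ ^ 2 + 4 *
      κ₃ + κ₄) * N) + 3 * ((1 + 3 * κ₂ + 3 * κ₂ ^ 2 + 4 * κ₃ + κ₄) * N ^ 2) + (1 + 3 * κ₂ + 3 * κ₂ ^ 2 + 4 * κ₃ + κ₄) * N ^ 3 := by ring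
  have e1 : ∀ v : EuclideanSpace ℝ ι, ‖v‖ ≤ 1 → |U' φ v| ≤ N := fun v hv =>
    (abs_entry_one_le _ _).trans (by nlinarith [norm_nonneg (U' φ), norm_nonneg v])
  have e2 : ∀ v w : EuclideanSpace ℝ ι, ‖v‖ ≤ 1 → ‖w‖ ≤ 1 → |U'' φ v w| ≤ κ₂ := fun v w hv hw => by
    calc |U'' φ v w| ≤ ‖U'' φ‖ * ‖v‖ * ‖w‖ := abs_entry_two_le _ _ _
      _ ≤ κ₂ * 1 * 1 := by gcongr; exact hU''b φ
      _ = κ₂ := by ring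
  have hA : |U₃ φ h k l| ≤ κ₃ := by
    calc |U₃ φ h k l| ≤ ‖U₃ φ‖ * ‖h‖ * ‖k‖ * ‖l‖ := abs_entry_three_le _ _ _ _
      _ ≤ κ₃ * 1 * 1 * 1 := by gcongr; exact hU₃b φ
      _ = κ₃ := by ring
  have hB : |U' φ k * U'' φ h l| ≤ N * κ₂ := by rw [abs_mul]; exact mul_le_mul (e1 k hk) (e2 h l hh hl) (abs_nonneg _) hN
  have hC : |U'' φ h k * U' φ l| ≤ κ₂ * N := by rw [abs_mul]; exact mul_le_mul (e2 h k hh hk) (e1 l hl) (abs_nonneg _) hκ₂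
  have hD : |U' φ h * U'' φ k l| ≤ N * κ₂ := by rw [abs_mul]; exact mul_le_mul (e1 h hh) (e2 k l hk hl) (abs_nonneg _) hN
  have hE : |U' φ h * U' φ k * U' φ l| ≤ N * N * N := by
    rw [abs_mul, abs_mul]
    exact mul_le_mul (mul_le_mul (e1 h hh) (e1 k hk) (abs_nonneg _) hN) (e1 l hl) (abs_nonneg _) (mul_nonneg hN hN)
  have habs : |(U₃ φ h k l - U' φ k * U'' φ h l - U'' φ h k * U' φ l - U' φ h * U'' φ k l + U' φ h * U' φ k * U' φ l)| ≤ κ₃ + N * κ₂ + κ₂ * N + N *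
      κ₂ + N * N * N := by
    have t1 := abs_sub (U₃ φ h k l - U' φ k * U'' φ h l - U'' φ h k * U' φ l - U' φ h * U'' φ k l) (-(U' φ h * U' φ k * U' φ l))
    have t2 := abs_sub (U₃ φ h k l - U' φ k * U'' φ h l - U'' φ h k * U' φ l) (U' φ h * U'' φ k l)
    have t3 := abs_sub (U₃ φ h k l - U' φ k * U'' φ h l) (U'' φ h k * U' φ l)
    have t4 := abs_sub (U₃ φ h k l) (U' φ k * U'' φ h l)
    rw [sub_neg_eq_add, abs_neg] at t1
    linarith
  rw [hexp]
  linarith only [habs, hCp3, f1, f2, f3]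

set_option maxHeartbeats 400000 in
omit [DecidableEq ι] in
/-- Growth of `p₃′`: `‖p₃′‖ ≤ (1+3κ₂+3κ₂²+4κ₃+κ₄)(1+‖U′‖)³` for directions of norm `≤ 1`. [folklore] -/
theorem norm_obs_three_deriv_le (hU''b : ∀ φ : EuclideanSpace ℝ ι, ‖U'' φ‖ ≤ κ₂) (hU₃b : ∀ φ : EuclideanSpace ℝ ι, ‖U₃ φ‖ ≤ κ₃)
    (hU₄b : ∀ φ : EuclideanSpace ℝ ι, ‖U₄ φ‖ ≤ κ₄) (hh : ‖h‖ ≤ 1) (hk : ‖k‖ ≤ 1) (hl : ‖l‖ ≤ 1) (φ : EuclideanSpace ℝ ι) :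
    ‖(((((ContinuousLinearMap.apply ℝ ℝ l).comp (ContinuousLinearMap.apply ℝ (EuclideanSpace ℝ ι →L[ℝ] ℝ) k)).comp (ContinuousLinearMap.apply ℝ
        (EuclideanSpace ℝ ι →L[ℝ] EuclideanSpace ℝ ι →L[ℝ] ℝ) h)).comp (U₄ φ)) - (U' φ k • (((ContinuousLinearMap.apply ℝ ℝ l).comp
        (ContinuousLinearMap.apply ℝ (EuclideanSpace ℝ ι →L[ℝ] ℝ) h)).comp (U₃ φ)) + U'' φ h l • ((ContinuousLinearMap.apply ℝ ℝ k).comp (U'' φ))) -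
        (U'' φ h k • ((ContinuousLinearMap.apply ℝ ℝ l).comp (U'' φ)) + U' φ l • (((ContinuousLinearMap.apply ℝ ℝ k).comp (ContinuousLinearMap.apply
        ℝ (EuclideanSpace ℝ ι →L[ℝ] ℝ) h)).comp (U₃ φ))) - (U' φ h • (((ContinuousLinearMap.apply ℝ ℝ l).comp (ContinuousLinearMap.apply ℝ
        (EuclideanSpace ℝ ι →L[ℝ] ℝ) k)).comp (U₃ φ)) + U'' φ k l • ((ContinuousLinearMap.apply ℝ ℝ h).comp (U'' φ))) + ((U' φ h * U' φ k) •
        ((ContinuousLinearMap.apply ℝ ℝ l).comp (U'' φ)) + U' φ l • (U' φ h • ((ContinuousLinearMap.apply ℝ ℝ k).comp (U'' φ)) + U' φ k •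
        ((ContinuousLinearMap.apply ℝ ℝ h).comp (U'' φ)))))‖ ≤
      (1 + 3 * κ₂ + 3 * κ₂ ^ 2 + 4 * κ₃ + κ₄) * (1 + ‖U' φ‖) ^ 3 := by
  have hκ₂ : 0 ≤ κ₂ := (norm_nonneg (U'' φ)).trans (hU''b φ)
  have hκ₃ : 0 ≤ κ₃ := (norm_nonneg (U₃ φ)).trans (hU₃b φ)
  have hκ₄ : 0 ≤ κ₄ := (norm_nonneg (U₄ φ)).trans (hU₄b φ)
  set N := ‖U' φ‖ with hNdef
  have hN : 0 ≤ N := norm_nonneg _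
  have hCp2 : κ₂ ≤ (1 + 3 * κ₂ + 3 * κ₂ ^ 2 + 4 * κ₃ + κ₄) := by nlinarith [sq_nonneg κ₂]
  have hCp3 : κ₃ ≤ (1 + 3 * κ₂ + 3 * κ₂ ^ 2 + 4 * κ₃ + κ₄) := by nlinarith [sq_nonneg κ₂]
  have f0 : κ₄ + 3 * (κ₂ * κ₂) ≤ (1 + 3 * κ₂ + 3 * κ₂ ^ 2 + 4 * κ₃ + κ₄) := by nlinarith [sq_nonneg κ₂]
  have f1 : N * κ₃ ≤ (1 + 3 * κ₂ + 3 * κ₂ ^ 2 + 4 * κ₃ + κ₄) * N := by nlinarith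
  have f2 : N * N * κ₂ ≤ (1 + 3 * κ₂ + 3 * κ₂ ^ 2 + 4 * κ₃ + κ₄) * N ^ 2 := by nlinarith [pow_nonneg hN 2]
  have f3 : 0 ≤ (1 + 3 * κ₂ + 3 * κ₂ ^ 2 + 4 * κ₃ + κ₄) * N ^ 3 := by positivity
  have hexp : (1 + 3 * κ₂ + 3 * κ₂ ^ 2 + 4 * κ₃ + κ₄) * (1 + N) ^ 3 = (1 + 3 * κ₂ + 3 * κ₂ ^ 2 + 4 * κ₃ + κ₄) + 3 * ((1 + 3 * κ₂ + 3 * κ₂ ^ 2 + 4 *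
      κ₃ + κ₄) * N) + 3 * ((1 + 3 * κ₂ + 3 * κ₂ ^ 2 + 4 * κ₃ + κ₄) * N ^ 2) + (1 + 3 * κ₂ + 3 * κ₂ ^ 2 + 4 * κ₃ + κ₄) * N ^ 3 := by ring
  have e1 : ∀ v : EuclideanSpace ℝ ι, ‖v‖ ≤ 1 → |U' φ v| ≤ N := fun v hv =>
    (abs_entry_one_le _ _).trans (by nlinarith [norm_nonneg (U' φ), norm_nonneg v])
  have e2 : ∀ v w : EuclideanSpace ℝ ι, ‖v‖ ≤ 1 → ‖w‖ ≤ 1 → |U'' φ v w| ≤ κ₂ := fun v w hv hw => by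
    calc |U'' φ v w| ≤ ‖U'' φ‖ * ‖v‖ * ‖w‖ := abs_entry_two_le _ _ _
      _ ≤ κ₂ * 1 * 1 := by gcongr; exact hU''b φ
      _ = κ₂ := by ring
  have d1 : ∀ v : EuclideanSpace ℝ ι, ‖v‖ ≤ 1 → ‖((ContinuousLinearMap.apply ℝ ℝ v).comp (U'' φ))‖ ≤ κ₂ := fun v hv =>
    (norm_eval_comp_one_le _ _).trans (by nlinarith [hU''b φ, norm_nonneg (U'' φ), norm_nonneg v])
  have d2 : ∀ v w : EuclideanSpace ℝ ι, ‖v‖ ≤ 1 → ‖w‖ ≤ 1 → ‖(((ContinuousLinearMap.apply ℝ ℝ w).comp (ContinuousLinearMap.apply ℝ (EuclideanSpace ℝ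
      ι →L[ℝ] ℝ) v)).comp (U₃ φ))‖ ≤ κ₃ := fun v w hv hw => by
    calc _ ≤ ‖v‖ * ‖w‖ * ‖U₃ φ‖ := norm_eval_comp_two_le _ _ _
      _ ≤ 1 * 1 * κ₃ := by gcongr; exact hU₃b φ
      _ = κ₃ := by ring
  -- the generic product bound `‖c • L‖ = |c|‖L‖`
  have sm : ∀ (c : ℝ) (L : EuclideanSpace ℝ ι →L[ℝ] ℝ) (bc bL : ℝ), |c| ≤ bc → ‖L‖ ≤ bL → 0 ≤ bc → ‖c • L‖ ≤ bc * bL := fun c L bc bL hc hL h0 => by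
    rw [norm_smul, Real.norm_eq_abs]; exact mul_le_mul hc hL (norm_nonneg _) h0
  -- the five summands (written out; no abstraction, so that every triangle inequality elaborates on literal terms)
  have hA : ‖((((ContinuousLinearMap.apply ℝ ℝ l).comp (ContinuousLinearMap.apply ℝ (EuclideanSpace ℝ ι →L[ℝ] ℝ) k)).comp (ContinuousLinearMap.apply
      ℝ (EuclideanSpace ℝ ι →L[ℝ] EuclideanSpace ℝ ι →L[ℝ] ℝ) h)).comp (U₄ φ))‖ ≤ κ₄ := by
    calc _ ≤ ‖h‖ * ‖k‖ * ‖l‖ * ‖U₄ φ‖ := norm_eval_comp_three_le (U₄ φ) h k l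
      _ ≤ 1 * 1 * 1 * κ₄ := by gcongr; exact hU₄b φ
      _ = κ₄ := by ring
  have hB : ‖U' φ k • (((ContinuousLinearMap.apply ℝ ℝ l).comp (ContinuousLinearMap.apply ℝ (EuclideanSpace ℝ ι →L[ℝ] ℝ) h)).comp (U₃ φ)) + U'' φ h l
      • ((ContinuousLinearMap.apply ℝ ℝ k).comp (U'' φ))‖ ≤ N * κ₃ + κ₂ * κ₂ :=
    (norm_add_le _ _).trans (add_le_add (sm _ _ _ _ (e1 k hk) (d2 h l hh hl) hN) (sm _ _ _ _ (e2 h l hh hl) (d1 k hk) hκ₂))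
  have hC : ‖U'' φ h k • ((ContinuousLinearMap.apply ℝ ℝ l).comp (U'' φ)) + U' φ l • (((ContinuousLinearMap.apply ℝ ℝ k).comp
      (ContinuousLinearMap.apply ℝ (EuclideanSpace ℝ ι →L[ℝ] ℝ) h)).comp (U₃ φ))‖ ≤ κ₂ * κ₂ + N * κ₃ :=
    (norm_add_le _ _).trans (add_le_add (sm _ _ _ _ (e2 h k hh hk) (d1 l hl) hκ₂) (sm _ _ _ _ (e1 l hl) (d2 h k hh hk) hN))
  have hD : ‖U' φ h • (((ContinuousLinearMap.apply ℝ ℝ l).comp (ContinuousLinearMap.apply ℝ (EuclideanSpace ℝ ι →L[ℝ] ℝ) k)).comp (U₃ φ)) + U'' φ k l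
      • ((ContinuousLinearMap.apply ℝ ℝ h).comp (U'' φ))‖ ≤ N * κ₃ + κ₂ * κ₂ :=
    (norm_add_le _ _).trans (add_le_add (sm _ _ _ _ (e1 h hh) (d2 k l hk hl) hN) (sm _ _ _ _ (e2 k l hk hl) (d1 h hh) hκ₂))
  have hE : ‖(U' φ h * U' φ k) • ((ContinuousLinearMap.apply ℝ ℝ l).comp (U'' φ)) + U' φ l • (U' φ h • ((ContinuousLinearMap.apply ℝ ℝ k).comp (U''
      φ)) + U' φ k • ((ContinuousLinearMap.apply ℝ ℝ h).comp (U'' φ)))‖ ≤ N * N * κ₂ + N * (N * κ₂ + N * κ₂) := by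
    refine (norm_add_le _ _).trans (add_le_add (sm _ _ _ _ ?_ (d1 l hl) (mul_nonneg hN hN)) (sm _ _ _ _ (e1 l hl) ?_ hN))
    · rw [abs_mul]; exact mul_le_mul (e1 h hh) (e1 k hk) (abs_nonneg _) hN
    · exact (norm_add_le _ _).trans (add_le_add (sm _ _ _ _ (e1 h hh) (d1 k hk) hN) (sm _ _ _ _ (e1 k hk) (d1 h hh) hN))
  have t1 := norm_sub_le ((((ContinuousLinearMap.apply ℝ ℝ l).comp (ContinuousLinearMap.apply ℝ (EuclideanSpace ℝ ι →L[ℝ] ℝ) k)).comp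
      (ContinuousLinearMap.apply ℝ (EuclideanSpace ℝ ι →L[ℝ] EuclideanSpace ℝ ι →L[ℝ] ℝ) h)).comp (U₄ φ)) (U' φ k • (((ContinuousLinearMap.apply ℝ ℝ
      l).comp (ContinuousLinearMap.apply ℝ (EuclideanSpace ℝ ι →L[ℝ] ℝ) h)).comp (U₃ φ)) + U'' φ h l • ((ContinuousLinearMap.apply ℝ ℝ k).comp (U''
      φ)))
  have t2 := norm_sub_le (((((ContinuousLinearMap.apply ℝ ℝ l).comp (ContinuousLinearMap.apply ℝ (EuclideanSpace ℝ ι →L[ℝ] ℝ) k)).comp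
      (ContinuousLinearMap.apply ℝ (EuclideanSpace ℝ ι →L[ℝ] EuclideanSpace ℝ ι →L[ℝ] ℝ) h)).comp (U₄ φ)) - (U' φ k • (((ContinuousLinearMap.apply ℝ
      ℝ l).comp (ContinuousLinearMap.apply ℝ (EuclideanSpace ℝ ι →L[ℝ] ℝ) h)).comp (U₃ φ)) + U'' φ h l • ((ContinuousLinearMap.apply ℝ ℝ k).comp (U''
      φ)))) (U'' φ h k • ((ContinuousLinearMap.apply ℝ ℝ l).comp (U'' φ)) + U' φ l • (((ContinuousLinearMap.apply ℝ ℝ k).comp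
      (ContinuousLinearMap.apply ℝ (EuclideanSpace ℝ ι →L[ℝ] ℝ) h)).comp (U₃ φ)))
  have t3 := norm_sub_le (((((ContinuousLinearMap.apply ℝ ℝ l).comp (ContinuousLinearMap.apply ℝ (EuclideanSpace ℝ ι →L[ℝ] ℝ) k)).comp
      (ContinuousLinearMap.apply ℝ (EuclideanSpace ℝ ι →L[ℝ] EuclideanSpace ℝ ι →L[ℝ] ℝ) h)).comp (U₄ φ)) - (U' φ k • (((ContinuousLinearMap.apply ℝ
      ℝ l).comp (ContinuousLinearMap.apply ℝ (EuclideanSpace ℝ ι →L[ℝ] ℝ) h)).comp (U₃ φ)) + U'' φ h l • ((ContinuousLinearMap.apply ℝ ℝ k).comp (U''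
      φ))) - (U'' φ h k • ((ContinuousLinearMap.apply ℝ ℝ l).comp (U'' φ)) + U' φ l • (((ContinuousLinearMap.apply ℝ ℝ k).comp
      (ContinuousLinearMap.apply ℝ (EuclideanSpace ℝ ι →L[ℝ] ℝ) h)).comp (U₃ φ)))) (U' φ h • (((ContinuousLinearMap.apply ℝ ℝ l).comp
      (ContinuousLinearMap.apply ℝ (EuclideanSpace ℝ ι →L[ℝ] ℝ) k)).comp (U₃ φ)) + U'' φ k l • ((ContinuousLinearMap.apply ℝ ℝ h).comp (U'' φ)))
  have t4 := norm_add_le (((((ContinuousLinearMap.apply ℝ ℝ l).comp (ContinuousLinearMap.apply ℝ (EuclideanSpace ℝ ι →L[ℝ] ℝ) k)).comp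
      (ContinuousLinearMap.apply ℝ (EuclideanSpace ℝ ι →L[ℝ] EuclideanSpace ℝ ι →L[ℝ] ℝ) h)).comp (U₄ φ)) - (U' φ k • (((ContinuousLinearMap.apply ℝ
      ℝ l).comp (ContinuousLinearMap.apply ℝ (EuclideanSpace ℝ ι →L[ℝ] ℝ) h)).comp (U₃ φ)) + U'' φ h l • ((ContinuousLinearMap.apply ℝ ℝ k).comp (U''
      φ))) - (U'' φ h k • ((ContinuousLinearMap.apply ℝ ℝ l).comp (U'' φ)) + U' φ l • (((ContinuousLinearMap.apply ℝ ℝ k).comp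
      (ContinuousLinearMap.apply ℝ (EuclideanSpace ℝ ι →L[ℝ] ℝ) h)).comp (U₃ φ))) - (U' φ h • (((ContinuousLinearMap.apply ℝ ℝ l).comp
      (ContinuousLinearMap.apply ℝ (EuclideanSpace ℝ ι →L[ℝ] ℝ) k)).comp (U₃ φ)) + U'' φ k l • ((ContinuousLinearMap.apply ℝ ℝ h).comp (U'' φ))))
      ((U' φ h * U' φ k) • ((ContinuousLinearMap.apply ℝ ℝ l).comp (U'' φ)) + U' φ l • (U' φ h • ((ContinuousLinearMap.apply ℝ ℝ k).comp (U'' φ)) +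
      U' φ k • ((ContinuousLinearMap.apply ℝ ℝ h).comp (U'' φ))))
  rw [hexp]
  linarith only [t1, t2, t3, t4, hA, hB, hC, hD, hE, f0, f1, f2, f3]

omit [DecidableEq ι] in
/-- `p₃′` is continuous in `φ`. [folklore] -/
theorem continuous_obs_three_deriv (hU'd : ∀ φ : EuclideanSpace ℝ ι, HasFDerivAt U' (U'' φ) φ)
    (hU''d : ∀ φ : EuclideanSpace ℝ ι, HasFDerivAt U'' (U₃ φ) φ) (hU₃c : Continuous U₃) (hU₄c : Continuous U₄) (h k l : EuclideanSpace ℝ ι) :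
    Continuous fun φ : EuclideanSpace ℝ ι => (((((ContinuousLinearMap.apply ℝ ℝ l).comp (ContinuousLinearMap.apply ℝ (EuclideanSpace ℝ ι →L[ℝ] ℝ)
        k)).comp (ContinuousLinearMap.apply ℝ (EuclideanSpace ℝ ι →L[ℝ] EuclideanSpace ℝ ι →L[ℝ] ℝ) h)).comp (U₄ φ)) - (U' φ k •
        (((ContinuousLinearMap.apply ℝ ℝ l).comp (ContinuousLinearMap.apply ℝ (EuclideanSpace ℝ ι →L[ℝ] ℝ) h)).comp (U₃ φ)) + U'' φ h l •
        ((ContinuousLinearMap.apply ℝ ℝ k).comp (U'' φ))) - (U'' φ h k • ((ContinuousLinearMap.apply ℝ ℝ l).comp (U'' φ)) + U' φ l •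
        (((ContinuousLinearMap.apply ℝ ℝ k).comp (ContinuousLinearMap.apply ℝ (EuclideanSpace ℝ ι →L[ℝ] ℝ) h)).comp (U₃ φ))) - (U' φ h •
        (((ContinuousLinearMap.apply ℝ ℝ l).comp (ContinuousLinearMap.apply ℝ (EuclideanSpace ℝ ι →L[ℝ] ℝ) k)).comp (U₃ φ)) + U'' φ k l •
        ((ContinuousLinearMap.apply ℝ ℝ h).comp (U'' φ))) + ((U' φ h * U' φ k) • ((ContinuousLinearMap.apply ℝ ℝ l).comp (U'' φ)) + U' φ l • (U' φ h
        • ((ContinuousLinearMap.apply ℝ ℝ k).comp (U'' φ)) + U' φ k • ((ContinuousLinearMap.apply ℝ ℝ h).comp (U'' φ))))) := by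
  have hU'c : Continuous U' := continuous_iff_continuousAt.2 fun φ => (hU'd φ).continuousAt
  have hU''c : Continuous U'' := continuous_iff_continuousAt.2 fun φ => (hU''d φ).continuousAt
  have c1 : ∀ v : EuclideanSpace ℝ ι, Continuous fun φ : EuclideanSpace ℝ ι => ((ContinuousLinearMap.apply ℝ ℝ v).comp (U'' φ)) := fun v =>
      continuous_const.clm_comp hU''c
  have c2 : ∀ v w : EuclideanSpace ℝ ι, Continuous fun φ : EuclideanSpace ℝ ι => (((ContinuousLinearMap.apply ℝ ℝ w).comp (ContinuousLinearMap.apply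
      ℝ (EuclideanSpace ℝ ι →L[ℝ] ℝ) v)).comp (U₃ φ)) := fun v w => continuous_const.clm_comp hU₃c
  have c3 : Continuous fun φ : EuclideanSpace ℝ ι => ((((ContinuousLinearMap.apply ℝ ℝ l).comp (ContinuousLinearMap.apply ℝ (EuclideanSpace ℝ ι →L[ℝ]
      ℝ) k)).comp (ContinuousLinearMap.apply ℝ (EuclideanSpace ℝ ι →L[ℝ] EuclideanSpace ℝ ι →L[ℝ] ℝ) h)).comp (U₄ φ)) := continuous_const.clm_comp
      hU₄c
  have s1 : ∀ v : EuclideanSpace ℝ ι, Continuous fun φ : EuclideanSpace ℝ ι => U' φ v := fun v => hU'c.clm_apply continuous_const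
  have s2 : ∀ v w : EuclideanSpace ℝ ι, Continuous fun φ : EuclideanSpace ℝ ι => U'' φ v w := fun v w => (hU''c.clm_apply continuous_const).clm_apply
      continuous_const
  exact ((((c3.sub (((s1 k).smul (c2 h l)).add ((s2 h l).smul (c1 k)))).sub (((s2 h k).smul (c1 l)).add ((s1 l).smul (c2 h k)))).sub
    (((s1 h).smul (c2 k l)).add ((s2 k l).smul (c1 h)))).add
    ((((s1 h).mul (s1 k)).smul (c1 l)).add ((s1 l).smul (((s1 h).smul (c1 k)).add ((s1 k).smul (c1 h))))))

end Entries

/-! ## §2. THE ENDS: `d_m Φ_{hkl}` -/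

section TheEnds

variable {Γ : Matrix ι ι ℝ} {γop : ℝ} {U : EuclideanSpace ℝ ι → ℝ} {U' : EuclideanSpace ℝ ι → EuclideanSpace ℝ ι →L[ℝ] ℝ}
  {U'' : EuclideanSpace ℝ ι → EuclideanSpace ℝ ι →L[ℝ] EuclideanSpace ℝ ι →L[ℝ] ℝ}
  {U₃ : EuclideanSpace ℝ ι → EuclideanSpace ℝ ι →L[ℝ] EuclideanSpace ℝ ι →L[ℝ] EuclideanSpace ℝ ι →L[ℝ] ℝ}
  {U₄ : EuclideanSpace ℝ ι → EuclideanSpace ℝ ι →L[ℝ] EuclideanSpace ℝ ι →L[ℝ] EuclideanSpace ℝ ι →L[ℝ] EuclideanSpace ℝ ι →L[ℝ] ℝ}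
  {κ₀ κ₁ κ₂ κ₃ κ₄ a τ δ θ : ℝ} {h k l : EuclideanSpace ℝ ι}

/-- **`d_m Φ_{hkl}`** for `‖h‖, ‖k‖, ‖l‖ ≤ 1`, at EVERY `ψ₀`. [folklore] -/
theorem hasFDerivAt_Phi_scalar (hΓ : Γ.PosSemidef) (hΓop : (γop • (1 : Matrix ι ι ℝ) - Γ).PosSemidef) (Y : Finset ι)
    (hUd : ∀ φ : EuclideanSpace ℝ ι, HasFDerivAt U (U' φ) φ) (hU'd : ∀ φ : EuclideanSpace ℝ ι, HasFDerivAt U' (U'' φ) φ)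
    (hU''d : ∀ φ : EuclideanSpace ℝ ι, HasFDerivAt U'' (U₃ φ) φ) (hU₃d : ∀ φ : EuclideanSpace ℝ ι, HasFDerivAt U₃ (U₄ φ) φ) (hU₄c : Continuous U₄)
    (hκ₀ : 0 ≤ κ₀) (hκ₁ : 0 ≤ κ₁) (ha : 0 ≤ a) (hτ : 0 < τ) (hδ : 0 < δ) (hθ1 : θ < 1) (hκθ : (2 * κ₀ * (1 + τ) + 4 * δ) * γop ≤ θ)
    (hstab : ∀ φ : EuclideanSpace ℝ ι, -(κ₀ * ∑ x ∈ Y, φ x ^ 2) ≤ U φ) (hU'b : ∀ φ : EuclideanSpace ℝ ι, ‖U' φ‖ ≤ κ₁ * (a + ∑ x ∈ Y, φ x ^ 2)) (hU''b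
        : ∀ φ : EuclideanSpace ℝ ι, ‖U'' φ‖ ≤ κ₂) (hU₃b : ∀ φ : EuclideanSpace ℝ ι, ‖U₃ φ‖ ≤ κ₃)
    (hU₄b : ∀ φ : EuclideanSpace ℝ ι, ‖U₄ φ‖ ≤ κ₄) (ψ₀ : EuclideanSpace ℝ ι) (hh : ‖h‖ ≤ 1) (hk : ‖k‖ ≤ 1) (hl : ‖l‖ ≤ 1) :
    HasFDerivAt (fun ψ : EuclideanSpace ℝ ι => ∫ ω : EuclideanSpace ℝ ι, exp (-U (ω + ψ)) * (U₃ (ω + ψ) h k l - U' (ω + ψ) k * U'' (ω + ψ) h l - U''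
        (ω + ψ) h k * U' (ω + ψ) l - U' (ω + ψ) h * U'' (ω + ψ) k l + U' (ω + ψ) h * U' (ω + ψ) k * U' (ω + ψ) l) ∂(multivariateGaussian 0 Γ))
      (∫ ω : EuclideanSpace ℝ ι, exp (-U (ω + ψ₀)) • ((((((ContinuousLinearMap.apply ℝ ℝ l).comp (ContinuousLinearMap.apply ℝ (EuclideanSpace ℝ ι
          →L[ℝ] ℝ) k)).comp (ContinuousLinearMap.apply ℝ (EuclideanSpace ℝ ι →L[ℝ] EuclideanSpace ℝ ι →L[ℝ] ℝ) h)).comp (U₄ (ω + ψ₀))) - (U' (ω + ψ₀)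
          k • (((ContinuousLinearMap.apply ℝ ℝ l).comp (ContinuousLinearMap.apply ℝ (EuclideanSpace ℝ ι →L[ℝ] ℝ) h)).comp (U₃ (ω + ψ₀))) + U'' (ω +
          ψ₀) h l • ((ContinuousLinearMap.apply ℝ ℝ k).comp (U'' (ω + ψ₀)))) - (U'' (ω + ψ₀) h k • ((ContinuousLinearMap.apply ℝ ℝ l).comp (U'' (ω +
          ψ₀))) + U' (ω + ψ₀) l • (((ContinuousLinearMap.apply ℝ ℝ k).comp (ContinuousLinearMap.apply ℝ (EuclideanSpace ℝ ι →L[ℝ] ℝ) h)).comp (U₃ (ω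
          + ψ₀)))) - (U' (ω + ψ₀) h • (((ContinuousLinearMap.apply ℝ ℝ l).comp (ContinuousLinearMap.apply ℝ (EuclideanSpace ℝ ι →L[ℝ] ℝ) k)).comp (U₃
          (ω + ψ₀))) + U'' (ω + ψ₀) k l • ((ContinuousLinearMap.apply ℝ ℝ h).comp (U'' (ω + ψ₀)))) + ((U' (ω + ψ₀) h * U' (ω + ψ₀) k) •
          ((ContinuousLinearMap.apply ℝ ℝ l).comp (U'' (ω + ψ₀))) + U' (ω + ψ₀) l • (U' (ω + ψ₀) h • ((ContinuousLinearMap.apply ℝ ℝ k).comp (U'' (ω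
          + ψ₀))) + U' (ω + ψ₀) k • ((ContinuousLinearMap.apply ℝ ℝ h).comp (U'' (ω + ψ₀)))))) - (U₃ (ω + ψ₀) h k l - U' (ω + ψ₀) k * U'' (ω + ψ₀) h
          l - U'' (ω + ψ₀) h k * U' (ω + ψ₀) l - U' (ω + ψ₀) h * U'' (ω + ψ₀) k l + U' (ω + ψ₀) h * U' (ω + ψ₀) k * U' (ω + ψ₀) l) • U' (ω + ψ₀))
          ∂(multivariateGaussian 0 Γ)) ψ₀ := by
  have hU'c : Continuous U' := continuous_iff_continuousAt.2 fun φ => (hU'd φ).continuousAt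
  have hU₃c : Continuous U₃ := continuous_iff_continuousAt.2 fun φ => (hU₃d φ).continuousAt
  exact hasFDerivAt_tilted_moment (p := fun φ => (U₃ φ h k l - U' φ k * U'' φ h l - U'' φ h k * U' φ l - U' φ h * U'' φ k l + U' φ h * U' φ k * U' φ
      l)) (p' := fun φ => (((((ContinuousLinearMap.apply ℝ ℝ l).comp (ContinuousLinearMap.apply ℝ (EuclideanSpace ℝ ι →L[ℝ] ℝ) k)).comp
      (ContinuousLinearMap.apply ℝ (EuclideanSpace ℝ ι →L[ℝ] EuclideanSpace ℝ ι →L[ℝ] ℝ) h)).comp (U₄ φ)) - (U' φ k • (((ContinuousLinearMap.apply ℝ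
      ℝ l).comp (ContinuousLinearMap.apply ℝ (EuclideanSpace ℝ ι →L[ℝ] ℝ) h)).comp (U₃ φ)) + U'' φ h l • ((ContinuousLinearMap.apply ℝ ℝ k).comp (U''
      φ))) - (U'' φ h k • ((ContinuousLinearMap.apply ℝ ℝ l).comp (U'' φ)) + U' φ l • (((ContinuousLinearMap.apply ℝ ℝ k).comp
      (ContinuousLinearMap.apply ℝ (EuclideanSpace ℝ ι →L[ℝ] ℝ) h)).comp (U₃ φ))) - (U' φ h • (((ContinuousLinearMap.apply ℝ ℝ l).comp
      (ContinuousLinearMap.apply ℝ (EuclideanSpace ℝ ι →L[ℝ] ℝ) k)).comp (U₃ φ)) + U'' φ k l • ((ContinuousLinearMap.apply ℝ ℝ h).comp (U'' φ))) +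
      ((U' φ h * U' φ k) • ((ContinuousLinearMap.apply ℝ ℝ l).comp (U'' φ)) + U' φ l • (U' φ h • ((ContinuousLinearMap.apply ℝ ℝ k).comp (U'' φ)) +
      U' φ k • ((ContinuousLinearMap.apply ℝ ℝ h).comp (U'' φ)))))) (Cp := (1 + 3 * κ₂ + 3 * κ₂ ^ 2 + 4 * κ₃ + κ₄)) (n := 3) hΓ hΓop Y hUd hU'c
    (fun φ => hasFDerivAt_obs_three hU'd hU''d hU₃d h k l φ) (continuous_obs_three_deriv hU'd hU''d hU₃c hU₄c h k l) hκ₀ hκ₁ ha hτ hδ hθ1 hκθ hstab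
        hU'b
    (fun φ => abs_obs_three_le hU''b hU₃b hU₄b hh hk hl φ) (fun φ => norm_obs_three_deriv_le hU''b hU₃b hU₄b hh hk hl φ) ψ₀

/-- **`(d_m Φ_{hkl}) = ∫e^{−U}Ψ_{hklm}`** with the fourth-order scalar integrand `Ψ` written out. [folklore] -/
theorem Phi_fderiv_apply (hΓ : Γ.PosSemidef) (hΓop : (γop • (1 : Matrix ι ι ℝ) - Γ).PosSemidef) (Y : Finset ι)
    (hUd : ∀ φ : EuclideanSpace ℝ ι, HasFDerivAt U (U' φ) φ) (hU'd : ∀ φ : EuclideanSpace ℝ ι, HasFDerivAt U' (U'' φ) φ)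
    (hU''d : ∀ φ : EuclideanSpace ℝ ι, HasFDerivAt U'' (U₃ φ) φ) (hU₃d : ∀ φ : EuclideanSpace ℝ ι, HasFDerivAt U₃ (U₄ φ) φ) (hU₄c : Continuous U₄)
    (hκ₀ : 0 ≤ κ₀) (hκ₁ : 0 ≤ κ₁) (ha : 0 ≤ a) (hτ : 0 < τ) (hδ : 0 < δ) (hθ1 : θ < 1) (hκθ : (2 * κ₀ * (1 + τ) + 4 * δ) * γop ≤ θ)
    (hstab : ∀ φ : EuclideanSpace ℝ ι, -(κ₀ * ∑ x ∈ Y, φ x ^ 2) ≤ U φ) (hU'b : ∀ φ : EuclideanSpace ℝ ι, ‖U' φ‖ ≤ κ₁ * (a + ∑ x ∈ Y, φ x ^ 2)) (hU''b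
        : ∀ φ : EuclideanSpace ℝ ι, ‖U'' φ‖ ≤ κ₂) (hU₃b : ∀ φ : EuclideanSpace ℝ ι, ‖U₃ φ‖ ≤ κ₃)
    (hU₄b : ∀ φ : EuclideanSpace ℝ ι, ‖U₄ φ‖ ≤ κ₄) (ψ₀ : EuclideanSpace ℝ ι) (hh : ‖h‖ ≤ 1) (hk : ‖k‖ ≤ 1) (hl : ‖l‖ ≤ 1) (m : EuclideanSpace ℝ ι) :
    (∫ ω : EuclideanSpace ℝ ι, exp (-U (ω + ψ₀)) • ((((((ContinuousLinearMap.apply ℝ ℝ l).comp (ContinuousLinearMap.apply ℝ (EuclideanSpace ℝ ι →L[ℝ]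
        ℝ) k)).comp (ContinuousLinearMap.apply ℝ (EuclideanSpace ℝ ι →L[ℝ] EuclideanSpace ℝ ι →L[ℝ] ℝ) h)).comp (U₄ (ω + ψ₀))) - (U' (ω + ψ₀) k •
        (((ContinuousLinearMap.apply ℝ ℝ l).comp (ContinuousLinearMap.apply ℝ (EuclideanSpace ℝ ι →L[ℝ] ℝ) h)).comp (U₃ (ω + ψ₀))) + U'' (ω + ψ₀) h l
        • ((ContinuousLinearMap.apply ℝ ℝ k).comp (U'' (ω + ψ₀)))) - (U'' (ω + ψ₀) h k • ((ContinuousLinearMap.apply ℝ ℝ l).comp (U'' (ω + ψ₀))) + U'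
        (ω + ψ₀) l • (((ContinuousLinearMap.apply ℝ ℝ k).comp (ContinuousLinearMap.apply ℝ (EuclideanSpace ℝ ι →L[ℝ] ℝ) h)).comp (U₃ (ω + ψ₀)))) -
        (U' (ω + ψ₀) h • (((ContinuousLinearMap.apply ℝ ℝ l).comp (ContinuousLinearMap.apply ℝ (EuclideanSpace ℝ ι →L[ℝ] ℝ) k)).comp (U₃ (ω + ψ₀))) +
        U'' (ω + ψ₀) k l • ((ContinuousLinearMap.apply ℝ ℝ h).comp (U'' (ω + ψ₀)))) + ((U' (ω + ψ₀) h * U' (ω + ψ₀) k) • ((ContinuousLinearMap.apply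
        ℝ ℝ l).comp (U'' (ω + ψ₀))) + U' (ω + ψ₀) l • (U' (ω + ψ₀) h • ((ContinuousLinearMap.apply ℝ ℝ k).comp (U'' (ω + ψ₀))) + U' (ω + ψ₀) k •
        ((ContinuousLinearMap.apply ℝ ℝ h).comp (U'' (ω + ψ₀)))))) - (U₃ (ω + ψ₀) h k l - U' (ω + ψ₀) k * U'' (ω + ψ₀) h l - U'' (ω + ψ₀) h k * U' (ω
        + ψ₀) l - U' (ω + ψ₀) h * U'' (ω + ψ₀) k l + U' (ω + ψ₀) h * U' (ω + ψ₀) k * U' (ω + ψ₀) l) • U' (ω + ψ₀)) ∂(multivariateGaussian 0 Γ)) m =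
      ∫ ω : EuclideanSpace ℝ ι, exp (-U (ω + ψ₀)) * (U₄ (ω + ψ₀) m h k l - U' (ω + ψ₀) k * U₃ (ω + ψ₀) m h l - U'' (ω + ψ₀) h l * U'' (ω + ψ₀) m k -
          U'' (ω + ψ₀) h k * U'' (ω + ψ₀) m l - U' (ω + ψ₀) l * U₃ (ω + ψ₀) m h k -
        U' (ω + ψ₀) h * U₃ (ω + ψ₀) m k l - U'' (ω + ψ₀) k l * U'' (ω + ψ₀) m h + U' (ω + ψ₀) h * U' (ω + ψ₀) k * U'' (ω + ψ₀) m l + U' (ω + ψ₀) h *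
            U' (ω + ψ₀) l * U'' (ω + ψ₀) m k +
        U' (ω + ψ₀) k * U' (ω + ψ₀) l * U'' (ω + ψ₀) m h - (U₃ (ω + ψ₀) h k l - U' (ω + ψ₀) k * U'' (ω + ψ₀) h l - U'' (ω + ψ₀) h k * U' (ω + ψ₀) l -
            U' (ω + ψ₀) h * U'' (ω + ψ₀) k l + U' (ω + ψ₀) h * U' (ω + ψ₀) k * U' (ω + ψ₀) l) * U' (ω + ψ₀) m) ∂(multivariateGaussian 0 Γ) := by
  have hU'c : Continuous U' := continuous_iff_continuousAt.2 fun φ => (hU'd φ).continuousAt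
  have hU₃c : Continuous U₃ := continuous_iff_continuousAt.2 fun φ => (hU₃d φ).continuousAt
  rw [tilted_moment_fderiv_apply (p := fun φ => (U₃ φ h k l - U' φ k * U'' φ h l - U'' φ h k * U' φ l - U' φ h * U'' φ k l + U' φ h * U' φ k * U' φ
      l)) (p' := fun φ => (((((ContinuousLinearMap.apply ℝ ℝ l).comp (ContinuousLinearMap.apply ℝ (EuclideanSpace ℝ ι →L[ℝ] ℝ) k)).comp
      (ContinuousLinearMap.apply ℝ (EuclideanSpace ℝ ι →L[ℝ] EuclideanSpace ℝ ι →L[ℝ] ℝ) h)).comp (U₄ φ)) - (U' φ k • (((ContinuousLinearMap.apply ℝ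
      ℝ l).comp (ContinuousLinearMap.apply ℝ (EuclideanSpace ℝ ι →L[ℝ] ℝ) h)).comp (U₃ φ)) + U'' φ h l • ((ContinuousLinearMap.apply ℝ ℝ k).comp (U''
      φ))) - (U'' φ h k • ((ContinuousLinearMap.apply ℝ ℝ l).comp (U'' φ)) + U' φ l • (((ContinuousLinearMap.apply ℝ ℝ k).comp
      (ContinuousLinearMap.apply ℝ (EuclideanSpace ℝ ι →L[ℝ] ℝ) h)).comp (U₃ φ))) - (U' φ h • (((ContinuousLinearMap.apply ℝ ℝ l).comp
      (ContinuousLinearMap.apply ℝ (EuclideanSpace ℝ ι →L[ℝ] ℝ) k)).comp (U₃ φ)) + U'' φ k l • ((ContinuousLinearMap.apply ℝ ℝ h).comp (U'' φ))) +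
      ((U' φ h * U' φ k) • ((ContinuousLinearMap.apply ℝ ℝ l).comp (U'' φ)) + U' φ l • (U' φ h • ((ContinuousLinearMap.apply ℝ ℝ k).comp (U'' φ)) +
      U' φ k • ((ContinuousLinearMap.apply ℝ ℝ h).comp (U'' φ)))))) (Cp := (1 + 3 * κ₂ + 3 * κ₂ ^ 2 + 4 * κ₃ + κ₄)) (n := 3) hΓ hΓop Y hUd hU'c
    (fun φ => hasFDerivAt_obs_three hU'd hU''d hU₃d h k l φ) (continuous_obs_three_deriv hU'd hU''d hU₃c hU₄c h k l) hκ₀ hκ₁ ha hτ hδ hθ1 hκθ hstab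
        hU'b
    (fun φ => abs_obs_three_le hU''b hU₃b hU₄b hh hk hl φ) (fun φ => norm_obs_three_deriv_le hU''b hU₃b hU₄b hh hk hl φ) ψ₀ m]
  refine integral_congr_ae (ae_of_all _ fun ω => ?_)
  simp only [ContinuousLinearMap.coe_comp, Function.comp_apply, ContinuousLinearMap.apply_apply, sub_apply, add_apply, smul_apply, smul_eq_mul]
  ring

end TheEnds

/-! ## §3. Toy -/

/-- Toy (the growth letter dominates the constant term: `κ₃ ≤ 1+3κ₂+3κ₂²+4κ₃+κ₄` for nonnegative letters). -/
example (κ₂ κ₃ κ₄ : ℝ) (h2 : 0 ≤ κ₂) (h3 : 0 ≤ κ₃) (h4 : 0 ≤ κ₄) : κ₃ ≤ 1 + 3 * κ₂ + 3 * κ₂ ^ 2 + 4 * κ₃ + κ₄ := by nlinarith [sq_nonneg κ₂]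

end Summit.QuantumFields.BalabanUV.T4Continuum.NE7b.SupTiltedMomentPhiConstituent

end
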